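/-
Copyright (c) 2026 the pub-hodgecm-mathlib formalisation cell (harness21).  Prover seat hodgecm-mathlib-LH7-p04 (g12), 2026-09-03.
Road M6 → F5 (LEAD F0P3a-plan (g16) T14-66 ∕ T15-32; SIG-F5-END v1), brick (B2a) «#FIX = #STABLE» — the model-level half of the 2-free class totals.
-/
import Literature.NumberTheory.Automorphic.UnitaryLatticeTreeFixedCosetStrataDictionary   -- ★ the bridge `ncard_fixedBy_quotient_sep_eq_ncard_selfDual_fixed_sep`; brings ★ `mem_glInt_iff_forall_v_le_one`
import Literature.NumberTheory.Automorphic.UnitaryLatticeTreeOrderStability              -- ★ `mapGL_eq_iff_map_toLin'_le` (fixed ↔ stable for a unit of the order)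
import Literature.NumberTheory.Automorphic.MatrixMoebiusShift                           -- ★ `MoebiusShift.inv_mem_adjoin_of_charpoly_coeff_mem` (Cayley–Hamilton inversion inside an order)
import Literature.NumberTheory.Automorphic.HyperspecialUnitaryCartanUnique               -- ★ `HermitianLattice.unitaryInt`, `mem_unitaryInt_iff`
import HarnessLib

/-!
# Fixed cosets of `U ⧸ U(𝒪)` versus self-dual lattices STABLE under a unitary element with integral characteristic polynomial

Topic `NumberTheory/Automorphic`; namespace `Literature.NumberTheory.Automorphic.UnitaryLatticeTree`.  THEOREMS ONLY (no definition, no instance, no notation, no named fact,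
no `sorry`).  Cell `pub/hodgecm-mathlib` (D-0151), crux H413 = `stmt-HodgeConjecture-24833`; road M6 → F5, brick **(B2a)** of SIG-F5-END v1 (LH7-p04 (g12)).

For a `ℤᵐ⁰`-valued field `K` with an isometric ring endomorphism `σ`, a form `J` with `det J ≠ 0` whose root lattice `L₀ = 𝒪^N` is self-dual and on whose self-dual lattices
`U = U(σ, J)(K)` acts transitively (the letters `hL₀ htrans` of ★ γ p853258 ∕ of the ★ bridge), and `t ∈ U` with INTEGRAL characteristic polynomial:
`#{q ∈ U ⧸ U(𝒪) : t·q = q} = #{M : M self-dual, t·M ⊆ M}` — the number Flicker counts (fixed hyperspecial vertices) equals the number the F3-5 spine computes (self-dual lattices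
STABLE under `t`).  Steps: `U(𝒪) := unitaryInt σ J` (entries of `g, g⁻¹` of valuation `≤ 1`) `= GL_N(𝒪) ∩ U` (★ `mem_glInt_iff_forall_v_le_one`); ★ bridge
`ncard_fixedBy_quotient_sep_eq_ncard_selfDual_fixed_sep` (trivial predicates); `t·M = M ↔ t·M ⊆ M` (★ `mapGL_eq_iff_map_toLin'_le`) because `t⁻¹ ∈ 𝒪[t]`: `|det t| = 1` from
`σ(det t)·det t = 1` (unitarity, `|σ·| = |·|`) and Cayley–Hamilton (★ `inv_mem_adjoin_of_charpoly_coeff_mem`).  No residue characteristic hypothesis.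
HONEST LABEL: count-neutral model-level glue; asserts nothing printed; HC_CM is proved only modulo the 2 remaining named inputs (hLiu418 24832, h413 24833) until rung 0 closes.

* `v_det_eq_one_of_mem_unitaryGroupOfForm` — `|det t| = 1` for `t ∈ U(σ, J)`, `det J ≠ 0`, `σ` isometric.
* `units_inv_mem_adjoin_of_charpoly_coeff_mem` — `t⁻¹ ∈ 𝒪[t]` for such `t` with integral `χ_t`.
* `mapGL_eq_iff_map_le_of_charpoly_coeff_mem` — `t·M = M ↔ t·M ⊆ M`.
* `unitaryInt_eq_glInt_subgroupOf` — `unitaryInt σ J = GL_N(𝒪) ⊓ U`.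
* **`natCard_fixedCosets_unitaryInt_eq_ncard_isSelfDualLattice_stable`** — the head.

## References
* [Kottwitz1986BaseChangeUnits] R. E. Kottwitz, *Base change for unit elements of Hecke algebras*, Compositio Math. 60 (1986): §3 (fixed points on the building ↔ stable lattices).
* [Rogawski1990] J. D. Rogawski, *Automorphic Representations of Unitary Groups in Three Variables*, Ann. of Math. Stud. 123 (1990): §4.9 p. 54 (the count of fixed vertices).
* [Flicker1998UnitaryFL] Y. Z. Flicker, *Elementary proof of the fundamental lemma for a unitary group*, Canad. J. Math. 50 (1998): §3 Prop. 5 p. 82.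
* [HornJohnson2013] R. A. Horn, C. R. Johnson, *Matrix Analysis*, 2nd ed. (2013): §2.1 (Cayley–Hamilton), §0.8.2.
-/

set_option autoImplicit false

noncomputable section

open Matrix Polynomial
open scoped Valued WithZero Matrix MatrixGroups

namespace Literature.NumberTheory.Automorphic.UnitaryLatticeTree

open Literature.NumberTheory.Automorphic Literature.NumberTheory.Automorphic.HermitianLattice Literature.NumberTheory.Automorphic.UnitaryGroup

variable {K : Type*} [Field K] [Valued K ℤᵐ⁰] {N : ℕ}

/-! ## §1 `|det t| = 1` and `t⁻¹ ∈ 𝒪[t]` for a unitary `t` with integral characteristic polynomial -/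

/-- **`|det t| = 1` on `U(σ, J)`** (`det J ≠ 0`, `σ` isometric): `σ(det t)·det J·det t = det J`. [cite: Rogawski1990, §4.9 p. 54] -/
theorem v_det_eq_one_of_mem_unitaryGroupOfForm {σ : K →+* K} (hvσ : ∀ a, Valued.v (σ a) = Valued.v a) {J : Matrix (Fin N) (Fin N) K} (hJ : J.det ≠ 0)
    {t : GL (Fin N) K} (ht : t ∈ unitaryGroupOfForm σ J) : Valued.v (t : Matrix (Fin N) (Fin N) K).det = 1 := by
  have h := congrArg Matrix.det (mem_unitaryGroupOfForm_iff.1 ht)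
  rw [Matrix.det_mul, Matrix.det_mul, Matrix.det_transpose] at h
  have hmap : ((t : Matrix (Fin N) (Fin N) K).map σ).det = σ (t : Matrix (Fin N) (Fin N) K).det := by
    rw [← RingHom.mapMatrix_apply, ← RingHom.map_det]
  rw [hmap] at h
  -- `σ(det t)·det t = 1`
  have h1 : σ (t : Matrix (Fin N) (Fin N) K).det * (t : Matrix (Fin N) (Fin N) K).det = 1 := by
    refine mul_right_cancel₀ hJ ?_
    rw [one_mul]
    calc σ (t : Matrix (Fin N) (Fin N) K).det * (t : Matrix (Fin N) (Fin N) K).det * J.det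
        = σ (t : Matrix (Fin N) (Fin N) K).det * J.det * (t : Matrix (Fin N) (Fin N) K).det := by ring
      _ = J.det := h
  have hv : Valued.v (t : Matrix (Fin N) (Fin N) K).det * Valued.v (t : Matrix (Fin N) (Fin N) K).det = 1 := by
    have := congrArg Valued.v h1
    rwa [map_mul, map_one, hvσ] at this
  -- in the linearly ordered `ℤᵐ⁰`: `x·x = 1 ⇒ x = 1`
  rcases le_total (Valued.v (t : Matrix (Fin N) (Fin N) K).det) 1 with hle | hge
  · refine le_antisymm hle ?_
    calc (1 : ℤᵐ⁰) = Valued.v (t : Matrix (Fin N) (Fin N) K).det * Valued.v (t : Matrix (Fin N) (Fin N) K).det := hv.symm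
      _ ≤ Valued.v (t : Matrix (Fin N) (Fin N) K).det * 1 := by gcongr
      _ = _ := mul_one _
  · refine le_antisymm ?_ hge
    calc Valued.v (t : Matrix (Fin N) (Fin N) K).det = Valued.v (t : Matrix (Fin N) (Fin N) K).det * 1 := (mul_one _).symm
      _ ≤ Valued.v (t : Matrix (Fin N) (Fin N) K).det * Valued.v (t : Matrix (Fin N) (Fin N) K).det := by gcongr
      _ = 1 := hv

/-- **`t⁻¹ ∈ 𝒪[t]`** for `t ∈ GL_N(K)` with `|det t| = 1` and integral characteristic polynomial (Cayley–Hamilton, ★ `MoebiusShift.inv_mem_adjoin_of_charpoly_coeff_mem`).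
[cite: HornJohnson2013, §2.1] [cite: Kottwitz1986BaseChangeUnits, §3] -/
theorem units_inv_mem_adjoin_of_charpoly_coeff_mem {t : GL (Fin N) K} (hdet : Valued.v (t : Matrix (Fin N) (Fin N) K).det = 1)
    (hint : ∀ i, (t : Matrix (Fin N) (Fin N) K).charpoly.coeff i ∈ 𝒪[K]) :
    ((t⁻¹ : GL (Fin N) K) : Matrix (Fin N) (Fin N) K) ∈ Algebra.adjoin 𝒪[K] ({(t : Matrix (Fin N) (Fin N) K)} : Set (Matrix (Fin N) (Fin N) K)) := by
  have hdet0 : (t : Matrix (Fin N) (Fin N) K).det ≠ 0 := (Valuation.ne_zero_iff _).1 (by rw [hdet]; exact one_ne_zero)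
  rw [Matrix.coe_units_inv]
  refine MoebiusShift.inv_mem_adjoin_of_charpoly_coeff_mem (Valued.integer K) (Algebra.self_mem_adjoin_singleton _ _) hint
    ⟨((t : Matrix (Fin N) (Fin N) K).det)⁻¹, ?_, inv_mul_cancel₀ hdet0⟩
  exact (Valuation.mem_integer_iff _ _).2 (by rw [map_inv₀, hdet, inv_one])

/-- **FIXED ↔ STABLE**: `t·M = M ↔ t·M ⊆ M` for every `𝒪`-submodule `M`, `t ∈ GL_N(K)` with `|det t| = 1` and integral characteristic polynomial.
[cite: Kottwitz1986BaseChangeUnits, §3] [cite: HornJohnson2013, §2.1] -/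
theorem mapGL_eq_iff_map_le_of_charpoly_coeff_mem (M : Submodule 𝒪[K] (Fin N → K)) {t : GL (Fin N) K}
    (hdet : Valued.v (t : Matrix (Fin N) (Fin N) K).det = 1) (hint : ∀ i, (t : Matrix (Fin N) (Fin N) K).charpoly.coeff i ∈ 𝒪[K]) :
    mapGL t M = M ↔ M.map ((Matrix.toLin' (t : Matrix (Fin N) (Fin N) K)).restrictScalars 𝒪[K]) ≤ M :=
  mapGL_eq_iff_map_toLin'_le M t (Algebra.self_mem_adjoin_singleton _ _) (units_inv_mem_adjoin_of_charpoly_coeff_mem hdet hint)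
    (Algebra.self_mem_adjoin_singleton _ _)

/-! ## §2 `U(𝒪) = GL_N(𝒪) ∩ U` and the head -/

variable [ValuativeRel K] [(Valued.v : Valuation K ℤᵐ⁰).Compatible]

/-- **`unitaryInt σ J = GL_N(𝒪) ⊓ U(σ, J)`** as subgroups of `U(σ, J)` (★ `mem_unitaryInt_iff` = entries of `g, g⁻¹` of valuation `≤ 1` = ★ `mem_glInt_iff_forall_v_le_one`).
[cite: Flicker1998UnitaryFL, §3 Prop. 5 p. 82] -/
theorem unitaryInt_eq_glInt_subgroupOf (σ : K →+* K) (J : Matrix (Fin N) (Fin N) K) :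
    unitaryInt σ J = (glInt N K).subgroupOf (unitaryGroupOfForm σ J) := by
  ext g
  rw [Subgroup.mem_subgroupOf, Literature.NumberTheory.Automorphic.mem_glInt_iff_forall_v_le_one, mem_unitaryInt_iff]

/-- **(B2a) `#{q ∈ U ⧸ U(𝒪) : t·q = q} = #{M : M self-dual, t·M ⊆ M}`** for `t ∈ U(σ, J)(K)` with integral characteristic polynomial, `σ` isometric, `det J ≠ 0`, the root
lattice self-dual and `U` transitive on self-dual lattices.  LEFT = the `G`-side count of ★ `natCard_fixedBy_cmLocalIntegralLevel_eq_of_frame` (after the frame `e`), RIGHT = the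
conclusion shape of ★ γ `ncard_isSelfDualLattice_stable_eq_phiTHn_of_eisensteinData` at `t = φb(g, u)`.
[cite: Kottwitz1986BaseChangeUnits, §3] [cite: Rogawski1990, §4.9 p. 54] [cite: Flicker1998UnitaryFL, §3 Prop. 5 p. 82] -/
theorem natCard_fixedCosets_unitaryInt_eq_ncard_isSelfDualLattice_stable {σ : K →+* K} (hvσ : ∀ a, Valued.v (σ a) = Valued.v a) (ϖ : K)
    {J : Matrix (Fin N) (Fin N) K} (hJ : J.det ≠ 0) (hL₀ : IsSelfDualLattice σ ϖ J (stdLattice K N))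
    (htrans : ∀ M : Submodule 𝒪[K] (Fin N → K), IsSelfDualLattice σ ϖ J M →
      ∃ u : ↥(unitaryGroupOfForm σ J), M = mapGL ((u : ↥(unitaryGroupOfForm σ J)) : GL (Fin N) K) (stdLattice K N))
    (t : ↥(unitaryGroupOfForm σ J)) (hint : ∀ i, (((t : ↥(unitaryGroupOfForm σ J)) : GL (Fin N) K) : Matrix (Fin N) (Fin N) K).charpoly.coeff i ∈ 𝒪[K]) :
    Nat.card {q : ↥(unitaryGroupOfForm σ J) ⧸ unitaryInt σ J | t • q = q} =
      {M : Submodule 𝒪[K] (Fin N → K) | IsSelfDualLattice σ ϖ J M ∧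
        M.map ((Matrix.toLin' (((t : ↥(unitaryGroupOfForm σ J)) : GL (Fin N) K) : Matrix (Fin N) (Fin N) K)).restrictScalars 𝒪[K]) ≤ M}.ncard := by
  classical
  have hdet := v_det_eq_one_of_mem_unitaryGroupOfForm hvσ hJ t.2
  rw [unitaryInt_eq_glInt_subgroupOf σ J, Nat.card_coe_set_eq]
  have hset : {q : ↥(unitaryGroupOfForm σ J) ⧸ (glInt N K).subgroupOf (unitaryGroupOfForm σ J) | t • q = q} =
      {q | q ∈ MulAction.fixedBy (↥(unitaryGroupOfForm σ J) ⧸ (glInt N K).subgroupOf (unitaryGroupOfForm σ J)) t ∧ (fun _ => True) (q.out⁻¹ * t * q.out)} := by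
    ext q; simp only [Set.mem_setOf_eq, MulAction.mem_fixedBy, and_true]
  rw [hset, ncard_fixedBy_quotient_sep_eq_ncard_selfDual_fixed_sep σ ϖ J hL₀ htrans t (fun _ => True) (fun _ => True) (fun _ _ => Iff.rfl)]
  congr 1
  ext M
  simp only [Set.mem_setOf_eq, and_true]
  exact and_congr_right fun _ => mapGL_eq_iff_map_le_of_charpoly_coeff_mem M hdet hint

end Literature.NumberTheory.Automorphic.UnitaryLatticeTree

end
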